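import Summits.ValiantsHypothesis.ValiantsHypothesis.Theses.LacunarySymmetroid

/-!
# Route LacunarySymmetroid — Assembly

The assembly item of route `route-ValiantsHypothesis-LacunarySymmetroid`:
`MatrixDescartes → PencilTransfer → ThetaWitness → ValiantsHypothesis`.
The route file already carries the sorry-free deciding theorem `closes`
(pure logic plus ℕ-arithmetic); the assembly is exactly its curried form.
-/

-- `Summit.ValiantsHypothesis.ValiantsHypothesis.…` is the tree's mandated single-conjunct layout
-- (Sub = Summit), so the duplicated namespace component is intended.
set_option linter.dupNamespace false

namespace Summit.ValiantsHypothesis.ValiantsHypothesis.Theorems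

open Summit.ValiantsHypothesis.ValiantsHypothesis.Theses.LacunarySymmetroid

/-- The assembly of route LacunarySymmetroid: the three cruxes `MatrixDescartes`,
`PencilTransfer`, `ThetaWitness` together imply `ValiantsHypothesis` (VP_ℂ ≠ VNP_ℂ).
Proof: the route's deciding theorem `closes`. -/
theorem lacunarySymmetroid_assembly_proof :
    Summit.ValiantsHypothesis.ValiantsHypothesis.Theses.LacunarySymmetroid.Assembly := by
  unfold Summit.ValiantsHypothesis.ValiantsHypothesis.Theses.LacunarySymmetroid.Assembly
  intro hMDR hT hW
  exact Summit.ValiantsHypothesis.ValiantsHypothesis.Theses.LacunarySymmetroid.closes hMDR hT hW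

end Summit.ValiantsHypothesis.ValiantsHypothesis.Theorems
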